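import Mathlib
import HarnessLib
import Summits.HubbardSuperconductivity.HubbardSuperconductivity.Theorems.KLProgrammeKLRegimeSplitTwoLegCoreTDSucc
import Summits.HubbardSuperconductivity.HubbardSuperconductivity.Theorems.KLProgrammeKLRegimeSplitTwoLegReadingTube
import Summits.HubbardSuperconductivity.HubbardSuperconductivity.Theorems.KLProgrammeKLRegimeSplitTwoLegFrameLipschitzNearFar
import Summits.HubbardSuperconductivity.HubbardSuperconductivity.Theorems.KLProgrammeKLRegimeSplitTwoLegTier1SizesCurve
import Summits.HubbardSuperconductivity.HubbardSuperconductivity.Theorems.KLProgrammeKLRegimeEngineV8DefsU4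

/-!
# Route `KLProgramme` — GEN-6 ENGINE (`KLRegimeEngineV16`, stmt-HubbardSuperconductivity-20236), two-leg stubs: the TUBE-KEYED `TwoLegCoreTD` closers
# (every hypothesis chain-free: curve sizes, shell-tube / flat-tube gradients, near responses, value sizes)

Cell `gate-hubbard-kl`, seat p1b (g7).  The CoreTD closers of record (`twoLegCoreTD_zero/succ_of_momentumSizes_degCap/_stub6`) take GLOBAL momentum-side
sizes; k3c5-p1 g7's finding (STATUS 07:54:22Z) + p1b 08:10:36Z: off the flat tube of the scale-`n` cutoff the unrenormalised counterterm chain makes them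
unfittable at deep scales.  These closers take instead, for the scale-`0` piece (`F = I_L[σ₀ − K∘p] = S₀ − K` under the cap) resp. the increment
(`F = S_{n+1} − S_n`):
* (E3a) the sizes `m k` / `Mv k`, `k ≤ 2`, AT THE FERMI POINTS `k_F^K(θ)` only (`…TwoLegTier1SizesCurve`);
* (E3c) a gradient bound `b` of `F` on the tube `{|frameLevel μ K| ≤ d}` (`0 < d`), the response `ρ·frameDist` for the NEAR capped comparison frames
  (`frameDist K K′ ≤ d`), and the value size at `k = 0` for every capped comparison frame with history; fits `ρ + b/klCurveD ≤ lipBar`, `2·m 0 ≤ lipBar·d`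
  (`…TwoLegFrameLipschitzNearFar`);
* (E3d/e) the field strength on the shell and a gradient bound `m₁'` of the K-separated reading `I_L[σ_n − K∘p]` on the SHELL TUBE
  `{|frameLevel μ K| ≤ Λ_n}` (`…TwoLegReadingTube.twoLegSlopes_of_fieldStrength_of_tubeGradient`; `∇S_n = ∇I_L[σ_n − K∘p] − ∇δ_K` under the cap).
§1 `twoLegCoreTD_zero_of_tubeSizes` / §2 `twoLegCoreTD_succ_of_tubeSizes` (named thresholds `klCurveC3 / klCurveU0`, generic `G P Q`); §3 the twins in
the REGISTERED gen-6 binders (`U ≤ klEngU₀4 P R c`, `G := klEngGeo5`, `Q := klEngQ5 P R`): `…_stub7`.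

Proofs only; nothing about the model is asserted.  References: BGM 2006 §2.4 (2.36) [cite: BenfattoGiulianiMastropietro2006].
-/

noncomputable section

namespace Summit.HubbardSuperconductivity.HubbardSuperconductivity.Theorems.KLRegimeSplit

set_option linter.dupNamespace false -- summit = problem name (single-conjunct summit), D-0017

open Real Finset
open Literature.MathematicalPhysics.QuantumLattice Literature.MathematicalPhysics.QuantumLattice.BandSectorCounting
open Literature.Probability.LatticeModels
open Summit.HubbardSuperconductivity.HubbardSuperconductivity.Theorems.DispersionFlow
open Summit.HubbardSuperconductivity.HubbardSuperconductivity.Theorems.PerturbedFermiCurve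
open Summit.HubbardSuperconductivity.HubbardSuperconductivity.Theorems.KLProgrammeLegKernels
open Summit.HubbardSuperconductivity.HubbardSuperconductivity.Theorems.TwoLegFourier
open Summit.HubbardSuperconductivity.HubbardSuperconductivity.Theorems.EngineV8

variable {L M : ℕ} [NeZero L] [NeZero M]

/-! ## §0 Under the cap: the reading `S_n` is the K-separated reading plus the frame, pointwise with its gradient -/

/-- Under the degree guard `K.degree ≤ L/2`: `evalM (symInterp L σ_n) = evalM (symInterp L (σ_n − K∘p)) + evalM K` as functions on `Momentum`. -/
theorem evalM_symInterp_eq_sep_add_frame {K : TrigPolyC4v} (hdeg : K.degree ≤ L / 2) (β U μ : ℝ) (n : ℕ) :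
    evalM (symInterp L (klLocSelfEnergyRe L M β U μ K n)) = fun q =>
      evalM (symInterp L (fun p => klLocSelfEnergyRe L M β U μ K n p - K.eval (latticeMomentum L p))) q + evalM K q := by
  funext q
  have hsplit : klLocSelfEnergyRe L M β U μ K n = fun p =>
      (klLocSelfEnergyRe L M β U μ K n p - K.eval (latticeMomentum L p)) + K.eval (latticeMomentum L p) := by
    funext p; ring
  conv_lhs => rw [hsplit]
  simp only [evalM_apply]
  rw [eval_symInterp_add, eval_symInterp_latticeValues_of_degree_le L K hdeg]

/-- Under the degree guard: a gradient bound `m₁'` of the K-separated reading at `q` gives `‖D(evalM S_n) q‖ ≤ m₁' + ‖D¹δ_K(q)‖`. -/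
theorem norm_fderiv_evalM_symInterp_le_of_sep_at {K : TrigPolyC4v} (hdeg : K.degree ≤ L / 2) (β U μ : ℝ) (n : ℕ) {m₁' : ℝ}
    (q : Momentum) (hq : ‖fderiv ℝ (evalM (symInterp L (fun p => klLocSelfEnergyRe L M β U μ K n p - K.eval (latticeMomentum L p)))) q‖ ≤ m₁') :
    ‖fderiv ℝ (evalM (symInterp L (klLocSelfEnergyRe L M β U μ K n))) q‖ ≤ m₁' + ‖iteratedFDeriv ℝ 1 (frameShift K) q‖ := by
  rw [evalM_symInterp_eq_sep_add_frame (L := L) (M := M) hdeg β U μ n]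
  have hF : DifferentiableAt ℝ (evalM (symInterp L (fun p => klLocSelfEnergyRe L M β U μ K n p - K.eval (latticeMomentum L p)))) q :=
    (differentiable_evalM _) q
  have hKd : DifferentiableAt ℝ (evalM K) q := (differentiable_evalM K) q
  have hKfs : evalM K = -frameShift K := by funext q; simp [evalM_apply, frameShift]
  rw [show (fun q => evalM (symInterp L (fun p => klLocSelfEnergyRe L M β U μ K n p - K.eval (latticeMomentum L p))) q + evalM K q) =
      evalM (symInterp L (fun p => klLocSelfEnergyRe L M β U μ K n p - K.eval (latticeMomentum L p))) + evalM K from rfl,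
    fderiv_add hF hKd]
  refine (norm_add_le _ _).trans (add_le_add hq ?_)
  rw [hKfs, fderiv_neg, norm_neg, norm_iteratedFDeriv_one]

/-! ## §1 Scale `0` -/

/-- **`TwoLegCoreTD hist G P Q R … K 0` FROM TUBE / CURVE DATA** (named thresholds).  For a capped frame at an engine volume; with
`F₀ := evalM (symInterp L (σ₀ − K∘p))` (= `evalM S₀ − evalM K` under the cap): curve sizes `m k` (`k ≤ 2`) with the tier-1 fits; a gradient bound `b₀` of `F₀`
on `{|frameLevel μ K| ≤ d}`, near responses `ρ₀`, value sizes `m 0` for every capped `K′`, `0 < d`, fits `ρ₀ + b₀/klCurveD ≤ lipBar G Q U 0`,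
`2·m 0 ≤ lipBar G Q U 0·d`; (E3d) on the shell; a gradient bound `m₁'` of `F₀` on the shell tube `{|frameLevel μ K| ≤ klScale klE0 0}` with
`m₁' + 4/3·Gfr₁U² ≤ cz|U|·(cDtmin(−1.2)(−0.05)/2)`. -/
theorem twoLegCoreTD_zero_of_tubeSizes {R : RenConsts} (hR : ∀ j, 0 ≤ R.Gfr j) {c : ℝ} (hc : 0 < c)
    (hcle : c ≤ klCurveC3 R) {U : ℝ} (hU : 0 < U) (hUle : U ≤ klCurveU0 R) {β : ℝ} (hβmin : klBetaMin ≤ β)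
    (hβc : β ≤ Real.exp (c / U ^ 2)) {μ : ℝ} (hμ : μ ∈ klWindowC) {K : TrigPolyC4v} (hKD : FrameOKDeg R U (nScales β) μ K)
    (hL : klEngL₃ β U ≤ L) (hist : TrigPolyC4v → ℕ → Prop) (G : GeoConsts) (P : SplitConsts) (Q : EngConsts)
    {m : ℕ → ℝ}
    (hm : ∀ k ≤ 2, ∀ θ : ℝ, ‖iteratedFDeriv ℝ k
      (evalM (symInterp L (fun q => klLocSelfEnergyRe L M β U μ K 0 q - K.eval (latticeMomentum L q))))
        (WithLp.toLp 2 (klFermiPoint μ K θ))‖ ≤ m k)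
    (hfitS : ∀ j ≤ 2, (if j = 0 then m 0 else 0) +
      (j.factorial : ℝ) ^ 2 * (2 * j.factorial * 1110 * 200 ^ j) *
        (if j = 0 then 2 * m 0 else (2 * π + 1) * (m 1 * klCurveD1) + (if j = 2 then m 2 * klCurveD1 ^ 2 + m 1 * klCurveD2 else 0)) *
        (4 + max 1 (((j - 1).factorial : ℝ) / (8 / 5))) ^ j ≤ twoLegBar G Q U j 0)
    {d b₀ ρ₀ : ℝ} (hd : 0 < d) (hb₀ : 0 ≤ b₀)
    (hg₀ : ∀ q : Momentum, |frameLevel μ K q| ≤ d →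
      ‖fderiv ℝ (evalM (symInterp L (fun p => klLocSelfEnergyRe L M β U μ K 0 p - K.eval (latticeMomentum L p)))) q‖ ≤ b₀)
    (hr₀ : ∀ K' : TrigPolyC4v, FrameOKDeg R U (klTempScaleIdx β klE0) μ K' → frameDist K K' ≤ d → ∀ θ : ℝ,
      |((symInterp L (klLocSelfEnergyRe L M β U μ K 0)).eval (klFermiPoint μ K' θ) - K.eval (klFermiPoint μ K' θ)) -
        ((symInterp L (klLocSelfEnergyRe L M β U μ K' 0)).eval (klFermiPoint μ K' θ) - K'.eval (klFermiPoint μ K' θ))| ≤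
        ρ₀ * frameDist K K')
    (hvK' : ∀ K' : TrigPolyC4v, FrameOKDeg R U (klTempScaleIdx β klE0) μ K' → ∀ θ : ℝ,
      |(symInterp L (klLocSelfEnergyRe L M β U μ K' 0)).eval (klFermiPoint μ K' θ) - K'.eval (klFermiPoint μ K' θ)| ≤ m 0)
    (hfitL : ρ₀ + b₀ / klCurveD ≤ lipBar G Q U 0) (hfar : 2 * m 0 ≤ lipBar G Q U 0 * d)
    (hz : ∀ k ∈ klShell L μ K 0, |klFieldStrength L M β U μ K 0 k - 1| ≤ R.cz * |U|)
    {m₁' : ℝ}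
    (hm₁' : ∀ q : Momentum, |frameLevel μ K q| ≤ klScale klE0 0 →
      ‖fderiv ℝ (evalM (symInterp L (fun p => klLocSelfEnergyRe L M β U μ K 0 p - K.eval (latticeMomentum L p)))) q‖ ≤ m₁')
    (hfit1 : m₁' + 4 / 3 * R.Gfr 1 * U ^ 2 ≤ R.cz * |U| * (cDtmin (-1.2) (-0.05) / 2)) :
    TwoLegCoreTD L M hist G P Q R β U μ K 0 := by
  have hK : FrameOK R U (nScales β) μ K := hKD.1
  have hdeg : K.degree ≤ L / 2 := hKD.degree_le_half rfl hβmin hL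
  have ha' : (-4 : ℝ) < -1.1 := by norm_num
  have hab : (-1.1 : ℝ) ≤ -0.1 := by norm_num
  have hb : (-0.1 : ℝ) < 0 := by norm_num
  obtain ⟨hAf, hA20, hADt, -, ⟨hlo, hhi⟩, -, -⟩ := frame_sizes_of_frameOK_explicit hR hc hcle hU hUle hβmin hβc hμ hK
  set Fg : Momentum → ℝ := evalM (symInterp L (fun q => klLocSelfEnergyRe L M β U μ K 0 q - K.eval (latticeMomentum L q))) with hFg
  -- under the cap the reading `S₀ − K` IS the K-separated reading
  have hsep := evalM_symInterp_eq_sep_add_frame (L := L) (M := M) hdeg β U μ 0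
  have hT : (fun q : Momentum => evalM (symInterp L (klLocSelfEnergyRe L M β U μ K 0)) q - evalM K q) = Fg := by
    funext q; rw [hsep]; simp [hFg]
  have hTθ : ∀ X : TrigPolyC4v, ∀ θ : ℝ, (symInterp L (klLocSelfEnergyRe L M β U μ X 0)).eval (klFermiPoint μ X θ) - X.eval (klFermiPoint μ X θ) =
      (fun q : Momentum => evalM (symInterp L (klLocSelfEnergyRe L M β U μ X 0)) q - evalM X q) (WithLp.toLp 2 (klFermiPoint μ X θ)) :=
    fun X θ => rfl
  -- no aliasing
  have ha0 : ∀ k ≤ 2, ∀ θ : ℝ, ‖iteratedFDeriv ℝ k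
      (fun p : Momentum => evalM (symInterp L (fun q => K.eval (latticeMomentum L q))) p - evalM K p)
        (WithLp.toLp 2 (klFermiPoint μ K θ))‖ ≤ (fun _ : ℕ => (0 : ℝ)) k :=
    fun k _ θ => by rw [iteratedFDeriv_symInterp_latticeValues_sub_eq_zero L K hdeg k _, norm_zero]
  have hνC : ∀ k : ℕ, ContDiff ℝ 4 (klLocalPart L M β U μ K k) := fun k =>
    contDiff_klLocalPart (bandBounds ha' hab hb) hAf hADt hlo hhi L M β U k
  refine ⟨⟨?_, fun j hj q => ?_⟩, ?_, ?_⟩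
  · have hKc : ContDiff ℝ 4 fun θ => K.eval (klFermiPoint μ K θ) := contDiff_eval_klFermiPoint (bandBounds ha' hab hb) hAf hADt hlo hhi K
    have hP := klTwoLegPieceFn_eval_zero (L := L) (M := M) β U μ K (hνC 0).continuous hKc.continuous
    have hδ : ContDiff ℝ (4 : ℕ∞) (fun θ => klLocalPart L M β U μ K 0 θ - K.eval (klFermiPoint μ K θ)) := by
      exact_mod_cast (hνC 0).sub hKc
    have hper : Function.Periodic (fun θ => klLocalPart L M β U μ K 0 θ - K.eval (klFermiPoint μ K θ)) (2 * π) := fun θ => by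
      simp only [klLocalPart_periodic β U μ K 0 θ, frameOnCurve_periodic μ K θ]
    exact_mod_cast contDiff_onM_piece hP hδ hper hμ
  · have h := twoLegPieceFn_eval_zero_tier1_size_le_curve (L := L) (M := M) hR hc hcle hU hUle hβmin hβc hμ hK hm ha0 hj
      (fun l hl x => norm_iteratedFDeriv_salmhoferCutoff_le_of_le_two (hl.trans hj) x) q
    simp only [add_zero] at h
    exact h.trans (hfitS j hj)
  · have hvK : ∀ θ : ℝ, |(symInterp L (klLocSelfEnergyRe L M β U μ K 0)).eval (klFermiPoint μ K θ) - K.eval (klFermiPoint μ K θ)| ≤ m 0 :=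
      fun θ => by
      rw [hTθ K θ, hT, ← Real.norm_eq_abs, ← norm_iteratedFDeriv_zero (𝕜 := ℝ)]
      exact hm 0 (by norm_num) θ
    have hg₀' : ∀ q : Momentum, |frameLevel μ K q| ≤ d → ‖fderiv ℝ (fun q : Momentum =>
        evalM (symInterp L (klLocSelfEnergyRe L M β U μ K 0)) q - evalM K q) q‖ ≤ b₀ := fun q hq => by rw [hT]; exact hg₀ q hq
    exact frameLipschitzFnTD_zero_of_nearFar (L := L) (M := M) hR hc hcle hU hUle hβmin hβc hμ hK hist G Q hd hb₀ hg₀' hr₀ hvK hvK' hfitL hfar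
  · have haw : (-4 : ℝ) < -1.2 := by norm_num
    have habw : (-1.2 : ℝ) ≤ -0.05 := by norm_num
    have hbw : (-0.05 : ℝ) < 0 := by norm_num
    set B := bandBounds haw habw hbw with hBdef
    have hBD : B.Dtmin = cDtmin (-1.2) (-0.05) := rfl
    have hAfw : ∀ p : Momentum, ∀ j ≤ 2, ‖iteratedFDeriv ℝ j (frameShift K) p‖ ≤
        2 * R.Gfr 0 * |U| + 2 * R.Gfr 1 * U ^ 2 + R.Gfr 2 * (c / Real.log 4) := fun p j hj =>
      norm_iteratedFDeriv_frameShift_le_of_frameOK_regime hR hc.le hβmin hβc hK p hj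
    obtain ⟨hA20w, hADtw, hhalf⟩ := two_frameSize_lt_cDtmin_wide hR hc.le hcle hU hUle
    have hADt' : 2 * (2 * R.Gfr 0 * |U| + 2 * R.Gfr 1 * U ^ 2 + R.Gfr 2 * (c / Real.log 4)) < B.Dtmin := by rw [hBD]; exact hADtw
    obtain ⟨hloΛ, hhiΛ⟩ := klWindowC_shell_margin hμ hA20w (klScale_klE0_le_klE0 0)
    have h13 : 0 ≤ 4 / 3 * R.Gfr 1 * U ^ 2 := by have := hR 1; positivity
    have hczU : 0 ≤ R.cz * |U| := by
      by_contra hneg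
      have hneg' : R.cz * |U| < 0 := lt_of_not_ge hneg
      have : R.cz * |U| * (cDtmin (-1.2) (-0.05) / 2) < 0 := mul_neg_of_neg_of_pos hneg' (by linarith [cDtmin_wide_ge])
      have h0 : 0 ≤ m₁' + 4 / 3 * R.Gfr 1 * U ^ 2 := by
        have hq := hm₁' (WithLp.toLp 2 (klFermiPoint μ K 0)) (by
          rw [frameLevel_klFermiPoint (bandBounds ha' hab hb) hAf hlo hhi 0, abs_zero]; unfold klScale klE0; positivity)
        linarith [norm_nonneg (fderiv ℝ Fg (WithLp.toLp 2 (klFermiPoint μ K 0)))]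
      linarith
    set bS : ℝ := m₁' + 4 / 3 * R.Gfr 1 * U ^ 2 with hbS
    have hbS0 : 0 ≤ bS := by
      have hq := hm₁' (WithLp.toLp 2 (klFermiPoint μ K 0)) (by
        rw [frameLevel_klFermiPoint (bandBounds ha' hab hb) hAf hlo hhi 0, abs_zero]; unfold klScale klE0; positivity)
      rw [hbS]; linarith [norm_nonneg (fderiv ℝ Fg (WithLp.toLp 2 (klFermiPoint μ K 0)))]
    have hgradS : ∀ q : Momentum, |frameLevel μ K q| ≤ klScale klE0 0 →
        ‖fderiv ℝ (evalM (symInterp L (klLocSelfEnergyRe L M β U μ K 0))) q‖ ≤ bS := fun q hq =>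
      (norm_fderiv_evalM_symInterp_le_of_sep_at (L := L) (M := M) hdeg β U μ 0 q (hm₁' q hq)).trans
        (by rw [hbS]; linarith [norm_iteratedFDeriv_one_frameShift_le_of_frameOK hR hK q])
    have hb' : bS ≤ R.cz * |U| * (B.Dtmin - 2 * (2 * R.Gfr 0 * |U| + 2 * R.Gfr 1 * U ^ 2 + R.Gfr 2 * (c / Real.log 4))) :=
      hfit1.trans (mul_le_mul_of_nonneg_left (by rw [hBD]; exact hhalf) hczU)
    exact twoLegSlopes_of_fieldStrength_of_tubeGradient B hAfw hADt' hloΛ hhiΛ (selfEnergySymmetric_all L M β U μ K 0) hz hbS0 hgradS hb'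

/-! ## §2 Scale `n + 1` -/

/-- **`TwoLegCoreTD hist G P Q R … K (n+1)` FROM TUBE / CURVE DATA** (named thresholds).  With `F := evalM (symInterp L (σ_{n+1} − σ_n))` (the increment)
and `F' := evalM (symInterp L (σ_{n+1} − K∘p))` (the K-separated reading): curve sizes `Mv k` (`k ≤ 2`) of `F` with the tier-1 fits; a gradient bound `b_Δ`
of `F` on `{|frameLevel μ K| ≤ d}`, near increment responses `ρ_Δ`, increment value sizes `Mv 0` for every capped `K′` with history, `0 < d`, fits
`ρ_Δ + b_Δ/klCurveD ≤ lipBar G Q U (n+1)`, `2·Mv 0 ≤ lipBar G Q U (n+1)·d`; (E3d) on the shell; a gradient bound `m₁'` of `F'` on the shell tube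
`{|frameLevel μ K| ≤ klScale klE0 (n+1)}` with `m₁' + 4/3·Gfr₁U² ≤ cz|U|·(cDtmin(−1.2)(−0.05)/2)`. -/
theorem twoLegCoreTD_succ_of_tubeSizes {R : RenConsts} (hR : ∀ j, 0 ≤ R.Gfr j) {c : ℝ} (hc : 0 < c)
    (hcle : c ≤ klCurveC3 R) {U : ℝ} (hU : 0 < U) (hUle : U ≤ klCurveU0 R) {β : ℝ} (hβmin : klBetaMin ≤ β)
    (hβc : β ≤ Real.exp (c / U ^ 2)) {μ : ℝ} (hμ : μ ∈ klWindowC) {K : TrigPolyC4v} (hKD : FrameOKDeg R U (nScales β) μ K)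
    (hL : klEngL₃ β U ≤ L) (hist : TrigPolyC4v → ℕ → Prop) (G : GeoConsts) (P : SplitConsts) (Q : EngConsts) (n : ℕ)
    {Mv : ℕ → ℝ}
    (hM : ∀ k ≤ 2, ∀ θ : ℝ, ‖iteratedFDeriv ℝ k
      (evalM (symInterp L fun q => klLocSelfEnergyRe L M β U μ K (n + 1) q - klLocSelfEnergyRe L M β U μ K n q))
        (WithLp.toLp 2 (klFermiPoint μ K θ))‖ ≤ Mv k)
    (hfitS : ∀ j ≤ 2, (if j = 0 then Mv 0 else 0) +
      (j.factorial : ℝ) ^ 2 * (2 * j.factorial * 1110 * 200 ^ j) *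
        (if j = 0 then 2 * Mv 0 else (2 * π + 1) * (Mv 1 * klCurveD1) + (if j = 2 then Mv 2 * klCurveD1 ^ 2 + Mv 1 * klCurveD2 else 0)) *
        (4 + max 1 (((j - 1).factorial : ℝ) / (8 / 5))) ^ j ≤ twoLegBar G Q U j (n + 1))
    {d bΔ ρΔ : ℝ} (hd : 0 < d) (hbΔ : 0 ≤ bΔ)
    (hg : ∀ q : Momentum, |frameLevel μ K q| ≤ d → ‖fderiv ℝ (fun q : Momentum =>
      evalM (symInterp L (klLocSelfEnergyRe L M β U μ K (n + 1))) q - evalM (symInterp L (klLocSelfEnergyRe L M β U μ K n)) q) q‖ ≤ bΔ)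
    (hr : ∀ K' : TrigPolyC4v, FrameOKDeg R U (klTempScaleIdx β klE0) μ K' → (∀ j < n + 1, hist K' j) → frameDist K K' ≤ d → ∀ θ : ℝ,
      |((symInterp L (klLocSelfEnergyRe L M β U μ K (n + 1))).eval (klFermiPoint μ K' θ) -
          (symInterp L (klLocSelfEnergyRe L M β U μ K n)).eval (klFermiPoint μ K' θ)) -
        ((symInterp L (klLocSelfEnergyRe L M β U μ K' (n + 1))).eval (klFermiPoint μ K' θ) -
          (symInterp L (klLocSelfEnergyRe L M β U μ K' n)).eval (klFermiPoint μ K' θ))| ≤ ρΔ * frameDist K K')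
    (hvK' : ∀ K' : TrigPolyC4v, FrameOKDeg R U (klTempScaleIdx β klE0) μ K' → (∀ j < n + 1, hist K' j) → ∀ θ : ℝ,
      |(symInterp L (klLocSelfEnergyRe L M β U μ K' (n + 1))).eval (klFermiPoint μ K' θ) -
        (symInterp L (klLocSelfEnergyRe L M β U μ K' n)).eval (klFermiPoint μ K' θ)| ≤ Mv 0)
    (hfitL : ρΔ + bΔ / klCurveD ≤ lipBar G Q U (n + 1)) (hfar : 2 * Mv 0 ≤ lipBar G Q U (n + 1) * d)
    (hz : ∀ k ∈ klShell L μ K (n + 1), |klFieldStrength L M β U μ K (n + 1) k - 1| ≤ R.cz * |U|)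
    {m₁' : ℝ}
    (hm₁' : ∀ q : Momentum, |frameLevel μ K q| ≤ klScale klE0 (n + 1) →
      ‖fderiv ℝ (evalM (symInterp L (fun p => klLocSelfEnergyRe L M β U μ K (n + 1) p - K.eval (latticeMomentum L p)))) q‖ ≤ m₁')
    (hfit1 : m₁' + 4 / 3 * R.Gfr 1 * U ^ 2 ≤ R.cz * |U| * (cDtmin (-1.2) (-0.05) / 2)) :
    TwoLegCoreTD L M hist G P Q R β U μ K (n + 1) := by
  have hK : FrameOK R U (nScales β) μ K := hKD.1
  have hdeg : K.degree ≤ L / 2 := hKD.degree_le_half rfl hβmin hL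
  have ha' : (-4 : ℝ) < -1.1 := by norm_num
  have hab : (-1.1 : ℝ) ≤ -0.1 := by norm_num
  have hb : (-0.1 : ℝ) < 0 := by norm_num
  obtain ⟨hAf, hA20, hADt, -, ⟨hlo, hhi⟩, -, -⟩ := frame_sizes_of_frameOK_explicit hR hc hcle hU hUle hβmin hβc hμ hK
  have hνC : ∀ k : ℕ, ContDiff ℝ 4 (klLocalPart L M β U μ K k) := fun k =>
    contDiff_klLocalPart (bandBounds ha' hab hb) hAf hADt hlo hhi L M β U k
  have hFθ : ∀ X : TrigPolyC4v, ∀ θ : ℝ, (symInterp L (klLocSelfEnergyRe L M β U μ X (n + 1))).eval (klFermiPoint μ X θ) -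
      (symInterp L (klLocSelfEnergyRe L M β U μ X n)).eval (klFermiPoint μ X θ) =
      evalM (symInterp L fun q => klLocSelfEnergyRe L M β U μ X (n + 1) q - klLocSelfEnergyRe L M β U μ X n q)
        (WithLp.toLp 2 (klFermiPoint μ X θ)) := fun X θ => by
    simp only [evalM_apply, eval_symInterp_sub]
  refine ⟨⟨?_, fun j hj q => ?_⟩, ?_, ?_⟩
  · have hP := klTwoLegPieceFn_eval_succ (L := L) (M := M) β U μ K n (hνC (n + 1)).continuous (hνC n).continuous
    have hδ : ContDiff ℝ (4 : ℕ∞) (fun θ => klLocalPart L M β U μ K (n + 1) θ - klLocalPart L M β U μ K n θ) := by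
      exact_mod_cast (hνC (n + 1)).sub (hνC n)
    have hper : Function.Periodic (fun θ => klLocalPart L M β U μ K (n + 1) θ - klLocalPart L M β U μ K n θ) (2 * π) := fun θ => by
      simp only [klLocalPart_periodic β U μ K (n + 1) θ, klLocalPart_periodic β U μ K n θ]
    exact_mod_cast contDiff_onM_piece hP hδ hper hμ
  · exact (twoLegPieceV13_tier1_size_le_curve (L := L) (M := M) hR hc hcle hU hUle hβmin hβc hμ hK n hM hj
      (fun l hl x => norm_iteratedFDeriv_salmhoferCutoff_le_of_le_two (hl.trans hj) x) q).trans (hfitS j hj)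
  · have hvK : ∀ θ : ℝ, |(symInterp L (klLocSelfEnergyRe L M β U μ K (n + 1))).eval (klFermiPoint μ K θ) -
        (symInterp L (klLocSelfEnergyRe L M β U μ K n)).eval (klFermiPoint μ K θ)| ≤ Mv 0 := fun θ => by
      rw [hFθ K θ, ← Real.norm_eq_abs, ← norm_iteratedFDeriv_zero (𝕜 := ℝ)]
      exact hM 0 (by norm_num) θ
    exact frameLipschitzFnTD_succ_of_nearFar (L := L) (M := M) hR hc hcle hU hUle hβmin hβc hμ hK hist G Q n hd hbΔ hg hr hvK hvK' hfitL hfar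
  · have haw : (-4 : ℝ) < -1.2 := by norm_num
    have habw : (-1.2 : ℝ) ≤ -0.05 := by norm_num
    have hbw : (-0.05 : ℝ) < 0 := by norm_num
    set B := bandBounds haw habw hbw with hBdef
    have hBD : B.Dtmin = cDtmin (-1.2) (-0.05) := rfl
    have hAfw : ∀ p : Momentum, ∀ j ≤ 2, ‖iteratedFDeriv ℝ j (frameShift K) p‖ ≤
        2 * R.Gfr 0 * |U| + 2 * R.Gfr 1 * U ^ 2 + R.Gfr 2 * (c / Real.log 4) := fun p j hj =>
      norm_iteratedFDeriv_frameShift_le_of_frameOK_regime hR hc.le hβmin hβc hK p hj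
    obtain ⟨hA20w, hADtw, hhalf⟩ := two_frameSize_lt_cDtmin_wide hR hc.le hcle hU hUle
    have hADt' : 2 * (2 * R.Gfr 0 * |U| + 2 * R.Gfr 1 * U ^ 2 + R.Gfr 2 * (c / Real.log 4)) < B.Dtmin := by rw [hBD]; exact hADtw
    obtain ⟨hloΛ, hhiΛ⟩ := klWindowC_shell_margin hμ hA20w (klScale_klE0_le_klE0 (n + 1))
    have h13 : 0 ≤ 4 / 3 * R.Gfr 1 * U ^ 2 := by have := hR 1; positivity
    have hm0 : 0 ≤ m₁' := by
      have hq := hm₁' (WithLp.toLp 2 (klFermiPoint μ K 0)) (by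
        rw [frameLevel_klFermiPoint (bandBounds ha' hab hb) hAf hlo hhi 0, abs_zero]; unfold klScale klE0; positivity)
      exact (norm_nonneg _).trans hq
    have hczU : 0 ≤ R.cz * |U| := by
      by_contra hneg
      have hneg' : R.cz * |U| < 0 := lt_of_not_ge hneg
      have : R.cz * |U| * (cDtmin (-1.2) (-0.05) / 2) < 0 := mul_neg_of_neg_of_pos hneg' (by linarith [cDtmin_wide_ge])
      linarith
    set bS : ℝ := m₁' + 4 / 3 * R.Gfr 1 * U ^ 2 with hbS
    have hbS0 : 0 ≤ bS := by positivity
    have hgradS : ∀ q : Momentum, |frameLevel μ K q| ≤ klScale klE0 (n + 1) →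
        ‖fderiv ℝ (evalM (symInterp L (klLocSelfEnergyRe L M β U μ K (n + 1)))) q‖ ≤ bS := fun q hq =>
      (norm_fderiv_evalM_symInterp_le_of_sep_at (L := L) (M := M) hdeg β U μ (n + 1) q (hm₁' q hq)).trans
        (by rw [hbS]; linarith [norm_iteratedFDeriv_one_frameShift_le_of_frameOK hR hK q])
    have hb' : bS ≤ R.cz * |U| * (B.Dtmin - 2 * (2 * R.Gfr 0 * |U| + 2 * R.Gfr 1 * U ^ 2 + R.Gfr 2 * (c / Real.log 4))) :=
      hfit1.trans (mul_le_mul_of_nonneg_left (by rw [hBD]; exact hhalf) hczU)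
    exact twoLegSlopes_of_fieldStrength_of_tubeGradient B hAfw hADt' hloΛ hhiΛ (selfEnergySymmetric_all L M β U μ K (n + 1)) hz hbS0
      hgradS hb'

/-! ## §3 The twins in the registered gen-6 binders (`U ≤ klEngU₀4 P R c`, `G := klEngGeo5`, `Q := klEngQ5 P R`) -/

/-- **Gen-6 stub-keyed, scale `0`, TUBE data** (`stub_twoLeg_scale0`'s literal binders of skeleton 8524e294bc0b68a6):
`TwoLegCoreTD L M hist klEngGeo5 P (klEngQ5 P R) R β U μ K 0`. -/
theorem twoLegCoreTD_zero_of_tubeSizes_stub7 (P : SplitConsts) {R : RenConsts} (hRW : R.WF2) {c : ℝ} (hc : 0 < c)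
    (hcle : c ≤ klEngC₃3 P R) {U : ℝ} (hU : 0 < U) (hUle : U ≤ klEngU₀4 P R c) {β : ℝ} (hβmin : klBetaMin ≤ β)
    (hβc : β ≤ Real.exp (c / U ^ 2)) {μ : ℝ} (hμ : μ ∈ klWindowC) {K : TrigPolyC4v} (hKD : FrameOKDeg R U (nScales β) μ K)
    (hL : klEngL₃ β U ≤ L) (hist : TrigPolyC4v → ℕ → Prop) {m : ℕ → ℝ}
    (hm : ∀ k ≤ 2, ∀ θ : ℝ, ‖iteratedFDeriv ℝ k
      (evalM (symInterp L (fun q => klLocSelfEnergyRe L M β U μ K 0 q - K.eval (latticeMomentum L q))))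
        (WithLp.toLp 2 (klFermiPoint μ K θ))‖ ≤ m k)
    (hfitS : ∀ j ≤ 2, (if j = 0 then m 0 else 0) +
      (j.factorial : ℝ) ^ 2 * (2 * j.factorial * 1110 * 200 ^ j) *
        (if j = 0 then 2 * m 0 else (2 * π + 1) * (m 1 * klCurveD1) + (if j = 2 then m 2 * klCurveD1 ^ 2 + m 1 * klCurveD2 else 0)) *
        (4 + max 1 (((j - 1).factorial : ℝ) / (8 / 5))) ^ j ≤ twoLegBar klEngGeo5 (klEngQ5 P R) U j 0)
    {d b₀ ρ₀ : ℝ} (hd : 0 < d) (hb₀ : 0 ≤ b₀)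
    (hg₀ : ∀ q : Momentum, |frameLevel μ K q| ≤ d →
      ‖fderiv ℝ (evalM (symInterp L (fun p => klLocSelfEnergyRe L M β U μ K 0 p - K.eval (latticeMomentum L p)))) q‖ ≤ b₀)
    (hr₀ : ∀ K' : TrigPolyC4v, FrameOKDeg R U (klTempScaleIdx β klE0) μ K' → frameDist K K' ≤ d → ∀ θ : ℝ,
      |((symInterp L (klLocSelfEnergyRe L M β U μ K 0)).eval (klFermiPoint μ K' θ) - K.eval (klFermiPoint μ K' θ)) -
        ((symInterp L (klLocSelfEnergyRe L M β U μ K' 0)).eval (klFermiPoint μ K' θ) - K'.eval (klFermiPoint μ K' θ))| ≤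
        ρ₀ * frameDist K K')
    (hvK' : ∀ K' : TrigPolyC4v, FrameOKDeg R U (klTempScaleIdx β klE0) μ K' → ∀ θ : ℝ,
      |(symInterp L (klLocSelfEnergyRe L M β U μ K' 0)).eval (klFermiPoint μ K' θ) - K'.eval (klFermiPoint μ K' θ)| ≤ m 0)
    (hfitL : ρ₀ + b₀ / klCurveD ≤ lipBar klEngGeo5 (klEngQ5 P R) U 0) (hfar : 2 * m 0 ≤ lipBar klEngGeo5 (klEngQ5 P R) U 0 * d)
    (hz : ∀ k ∈ klShell L μ K 0, |klFieldStrength L M β U μ K 0 k - 1| ≤ R.cz * |U|)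
    {m₁' : ℝ}
    (hm₁' : ∀ q : Momentum, |frameLevel μ K q| ≤ klScale klE0 0 →
      ‖fderiv ℝ (evalM (symInterp L (fun p => klLocSelfEnergyRe L M β U μ K 0 p - K.eval (latticeMomentum L p)))) q‖ ≤ m₁')
    (hfit1 : m₁' + 4 / 3 * R.Gfr 1 * U ^ 2 ≤ R.cz * |U| * (cDtmin (-1.2) (-0.05) / 2)) :
    TwoLegCoreTD L M hist klEngGeo5 P (klEngQ5 P R) R β U μ K 0 :=
  have hR : ∀ j, 0 ≤ R.Gfr j := hRW.1.2.2
  twoLegCoreTD_zero_of_tubeSizes (L := L) (M := M) hR hc (hcle.trans (klEngC₃3_le_klCurveC3 P hR)) hU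
    ((le_klEngU₀3_of_le_klEngU₀4 hUle).trans (klEngU₀3_le_klCurveU0 P hR c)) hβmin hβc hμ hKD hL hist klEngGeo5 P (klEngQ5 P R)
    hm hfitS hd hb₀ hg₀ hr₀ hvK' hfitL hfar hz hm₁' hfit1

/-- **Gen-6 stub-keyed, scale `n + 1`, TUBE data** (`stub_twoLeg_step`'s literal binders): `TwoLegCoreTD L M hist klEngGeo5 P (klEngQ5 P R) R β U μ K (n+1)`. -/
theorem twoLegCoreTD_succ_of_tubeSizes_stub7 (P : SplitConsts) {R : RenConsts} (hRW : R.WF2) {c : ℝ} (hc : 0 < c)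
    (hcle : c ≤ klEngC₃3 P R) {U : ℝ} (hU : 0 < U) (hUle : U ≤ klEngU₀4 P R c) {β : ℝ} (hβmin : klBetaMin ≤ β)
    (hβc : β ≤ Real.exp (c / U ^ 2)) {μ : ℝ} (hμ : μ ∈ klWindowC) {K : TrigPolyC4v} (hKD : FrameOKDeg R U (nScales β) μ K)
    (hL : klEngL₃ β U ≤ L) (hist : TrigPolyC4v → ℕ → Prop) (n : ℕ) {Mv : ℕ → ℝ}
    (hM : ∀ k ≤ 2, ∀ θ : ℝ, ‖iteratedFDeriv ℝ k
      (evalM (symInterp L fun q => klLocSelfEnergyRe L M β U μ K (n + 1) q - klLocSelfEnergyRe L M β U μ K n q))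
        (WithLp.toLp 2 (klFermiPoint μ K θ))‖ ≤ Mv k)
    (hfitS : ∀ j ≤ 2, (if j = 0 then Mv 0 else 0) +
      (j.factorial : ℝ) ^ 2 * (2 * j.factorial * 1110 * 200 ^ j) *
        (if j = 0 then 2 * Mv 0 else (2 * π + 1) * (Mv 1 * klCurveD1) + (if j = 2 then Mv 2 * klCurveD1 ^ 2 + Mv 1 * klCurveD2 else 0)) *
        (4 + max 1 (((j - 1).factorial : ℝ) / (8 / 5))) ^ j ≤ twoLegBar klEngGeo5 (klEngQ5 P R) U j (n + 1))
    {d bΔ ρΔ : ℝ} (hd : 0 < d) (hbΔ : 0 ≤ bΔ)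
    (hg : ∀ q : Momentum, |frameLevel μ K q| ≤ d → ‖fderiv ℝ (fun q : Momentum =>
      evalM (symInterp L (klLocSelfEnergyRe L M β U μ K (n + 1))) q - evalM (symInterp L (klLocSelfEnergyRe L M β U μ K n)) q) q‖ ≤ bΔ)
    (hr : ∀ K' : TrigPolyC4v, FrameOKDeg R U (klTempScaleIdx β klE0) μ K' → (∀ j < n + 1, hist K' j) → frameDist K K' ≤ d → ∀ θ : ℝ,
      |((symInterp L (klLocSelfEnergyRe L M β U μ K (n + 1))).eval (klFermiPoint μ K' θ) -
          (symInterp L (klLocSelfEnergyRe L M β U μ K n)).eval (klFermiPoint μ K' θ)) -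
        ((symInterp L (klLocSelfEnergyRe L M β U μ K' (n + 1))).eval (klFermiPoint μ K' θ) -
          (symInterp L (klLocSelfEnergyRe L M β U μ K' n)).eval (klFermiPoint μ K' θ))| ≤ ρΔ * frameDist K K')
    (hvK' : ∀ K' : TrigPolyC4v, FrameOKDeg R U (klTempScaleIdx β klE0) μ K' → (∀ j < n + 1, hist K' j) → ∀ θ : ℝ,
      |(symInterp L (klLocSelfEnergyRe L M β U μ K' (n + 1))).eval (klFermiPoint μ K' θ) -
        (symInterp L (klLocSelfEnergyRe L M β U μ K' n)).eval (klFermiPoint μ K' θ)| ≤ Mv 0)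
    (hfitL : ρΔ + bΔ / klCurveD ≤ lipBar klEngGeo5 (klEngQ5 P R) U (n + 1))
    (hfar : 2 * Mv 0 ≤ lipBar klEngGeo5 (klEngQ5 P R) U (n + 1) * d)
    (hz : ∀ k ∈ klShell L μ K (n + 1), |klFieldStrength L M β U μ K (n + 1) k - 1| ≤ R.cz * |U|)
    {m₁' : ℝ}
    (hm₁' : ∀ q : Momentum, |frameLevel μ K q| ≤ klScale klE0 (n + 1) →
      ‖fderiv ℝ (evalM (symInterp L (fun p => klLocSelfEnergyRe L M β U μ K (n + 1) p - K.eval (latticeMomentum L p)))) q‖ ≤ m₁')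
    (hfit1 : m₁' + 4 / 3 * R.Gfr 1 * U ^ 2 ≤ R.cz * |U| * (cDtmin (-1.2) (-0.05) / 2)) :
    TwoLegCoreTD L M hist klEngGeo5 P (klEngQ5 P R) R β U μ K (n + 1) :=
  have hR : ∀ j, 0 ≤ R.Gfr j := hRW.1.2.2
  twoLegCoreTD_succ_of_tubeSizes (L := L) (M := M) hR hc (hcle.trans (klEngC₃3_le_klCurveC3 P hR)) hU
    ((le_klEngU₀3_of_le_klEngU₀4 hUle).trans (klEngU₀3_le_klCurveU0 P hR c)) hβmin hβc hμ hKD hL hist klEngGeo5 P (klEngQ5 P R) n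
    hM hfitS hd hbΔ hg hr hvK' hfitL hfar hz hm₁' hfit1

end Summit.HubbardSuperconductivity.HubbardSuperconductivity.Theorems.KLRegimeSplit

end
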